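import Literature.Geometry.Lorentzian.TranslationalKIDsOfMassZero
import Literature.Geometry.Lorentzian.SpacetimePositiveMassRigidityReduction
import HarnessLib

/-!
# Reductions of the analytic half `beigChrusciel_translationalKIDs_of_admEnergy_zero`

The rigid positive energy theorem `positive_mass_rigidity_spacetime` (Beig–Chruściel, J. Math.
Phys. 37 (1996), Thm. 4.1, `m = 0`) is proved in the tree from the named fact
`beigChrusciel_translationalKIDs_of_admEnergy_zero` (`TranslationalKIDsOfMassZero.lean`,
`positive_mass_rigidity_spacetime_of_analyticHalf`): the existence of four global smooth
translational KIDs with Gram matrix `η`, `N₀ > 0` and `N₀` BOUNDED. This file records two proved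
weakenings of what a prover of that fact has to establish:

* `beigChrusciel_translationalKIDs_of_admEnergy_zero_of_unbounded` — **the boundedness clause
  is automatic**: the lapse `N₀` of the timelike KID is bounded on an asymptotically flat,
  one-ended data manifold by the lapse equation, the Gram identity and `k = O(r⁻²)`
  (`AFEnd.exists_forall_lapse_le`, `TranslationalKIDBoundedLapse.lean`; Beig–Chruściel 1996,
  §2, Prop. 2.2);
* `beigChrusciel_translationalKIDs_of_admEnergy_zero_of_witten` — **the fact follows from a
  global orthonormal frame and Witten's parallel spinors**: by the formalised algebra of App. A
  (`SenParallelSpinorKID.lean`, `SenParallelKIDTetrad.lean`, `PauliSpinorModel.lean`) it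
  suffices to have (Fr) a smooth global `h`-orthonormal frame and (W) for every such frame two
  smooth spinor fields `X → ℝ⁴ ≅ ℂ²`, parallel for the Sen–Witten connection of the frame and
  tending to the standard basis along some nontrivial filter (Witten 1981, §3; Parker–Taubes
  1982; Beig–Chruściel 1996, App. A, (A.7)–(A.10));
* `positive_mass_rigidity_spacetime_of_frame_of_witten` — hence the rigidity theorem itself
  from (Fr) and (W) alone.

Theorems only; no definitions, no named facts (the inputs are binders).

## References

* R. Beig, P. T. Chruściel, *Killing vectors in asymptotically flat space-times. I*, J. Math.
  Phys. 37 (1996) 1939–1961, arXiv:gr-qc/9510015: §2, Prop. 2.2; Thm. 4.1, §4; App. A,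
  (A.7)–(A.11.0). [BeigChrusciel1996]
* E. Witten, *A new proof of the positive energy theorem*, Comm. Math. Phys. 80 (1981)
  381–402, §3. [Witten1981]
-/

noncomputable section

open Bundle Set Function Manifold Filter
open scoped Manifold ContDiff Topology

namespace Literature.Geometry.Lorentzian

/-- **The boundedness of the lapse is automatic.** The analytic half
`beigChrusciel_translationalKIDs_of_admEnergy_zero` follows from its version WITHOUT the clause
`∃ C, ∀ x, N₀ x ≤ C`: on an asymptotically flat one-ended data manifold the lapse of a KID with
`h(Y₀, Y₀) = N₀² − 1` is bounded (`AFEnd.exists_forall_lapse_le`; Beig–Chruściel 1996, §2,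
Prop. 2.2). [cite: BeigChrusciel1996, §2, Prop. 2.2 and App. A] -/
theorem beigChrusciel_translationalKIDs_of_admEnergy_zero_of_unbounded
    (hA : ∀ (X : Type) [TopologicalSpace X] [ChartedSpace E3 X] [IsManifold (𝓡 3) ∞ X]
      [T2Space X] [SecondCountableTopology X] [ConnectedSpace X]
      (D : InitialDataSet (𝓡 3) X) [D.metric.HasLeviCivita] (e : AFEnd X),
      D.SatisfiesDominantEnergyCondition → e.IsAsymptoticallyFlat D 1 →
      (∃ q₀, HasSourceDecay e D q₀) → e.IsSoleEnd → e.HasADMEnergy D 0 →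
      ∃ (N : Fin 4 → X → ℝ) (Y : Fin 4 → Π x : X, TangentSpace (𝓡 3) x),
        (∀ a, ContMDiff (𝓡 3) 𝓘(ℝ, ℝ) ∞ (N a)) ∧
        (∀ a, ContMDiff (𝓡 3) ((𝓡 3).prod (𝓡 3)) ∞
          fun x ↦ (TotalSpace.mk' E3 x (Y a x) : TangentBundle (𝓡 3) X)) ∧
        (∀ a (x : X) (v w : TangentSpace (𝓡 3) x),
          D.metric.val x (D.metric.leviCivita (Y a) x v) w = -(N a x * D.k x v w)) ∧
        (∀ a (x : X) (v : TangentSpace (𝓡 3) x),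
          mvfderiv (𝓡 3) (N a) x v = -(D.k x v (Y a x))) ∧
        (∀ (x : X) a b, -(N a x * N b x) + D.h.inner x (Y a x) (Y b x) =
          if a = b then (if a = 0 then -1 else 1) else 0) ∧
        ∀ x, 0 < N 0 x) :
    beigChrusciel_translationalKIDs_of_admEnergy_zero := by
  intro X _ _ _ _ _ _ D _ e hdec haf hsrc hsole hE
  obtain ⟨N, Y, hN, hY, hDY, hdN, hG, hN0⟩ := hA X D e hdec haf hsrc hsole hE
  have hYN : ∀ x, D.h.inner x (Y 0 x) (Y 0 x) ≤ N 0 x ^ 2 := fun x ↦ by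
    have h := hG x 0 0
    simp only [↓reduceIte] at h
    nlinarith
  obtain ⟨B, hNB⟩ := AFEnd.exists_forall_lapse_le one_pos haf hsole
    (fun x ↦ (hN 0 x).mdifferentiableAt (by simp)) (hdN 0) hYN hN0
  exact ⟨N, Y, hN, hY, hDY, hdN, hG, hN0, B, hNB⟩

/-- **The analytic half from a global orthonormal frame and Witten's spinors.** Granted

* `hFr` — under the hypotheses of the rigidity theorem, `X` carries a smooth global
  `h`-orthonormal frame `(F₁, F₂, F₃)`;
* `hW` — under the same hypotheses, for every such frame there are two smooth spinor fields
  `ψ₁, ψ₂ : X → ℝ⁴ ≅ ℂ²` parallel for the Sen–Witten connection of the frame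
  (`dψ(v) = ¼ Σ h(∇ᵥFᵢ, Fⱼ) σᵢσⱼψ − ½ Σ k(v, Fᵢ) σᵢψ`, real Pauli operators
  `PauliModel.pauli`) and tending to the standard basis `(1,0)`, `(0,1)` along some nontrivial
  filter on `X` (Witten's theorem for `E_ADM = 0`),

the named fact `beigChrusciel_translationalKIDs_of_admEnergy_zero` holds
(`PauliModel.exists_kids_of_pauli_parallel_spinors_of_tendsto` and the automatic boundedness of
the lapse). [cite: BeigChrusciel1996, App. A, (A.7)–(A.11.0)] -/
theorem beigChrusciel_translationalKIDs_of_admEnergy_zero_of_witten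
    (hFr : ∀ (X : Type) [TopologicalSpace X] [ChartedSpace E3 X] [IsManifold (𝓡 3) ∞ X]
      [T2Space X] [SecondCountableTopology X] [ConnectedSpace X]
      (D : InitialDataSet (𝓡 3) X) [D.metric.HasLeviCivita] (e : AFEnd X),
      D.SatisfiesDominantEnergyCondition → e.IsAsymptoticallyFlat D 1 →
      (∃ q₀, HasSourceDecay e D q₀) → e.IsSoleEnd → e.HasADMEnergy D 0 →
      ∃ F : Fin 3 → Π x : X, TangentSpace (𝓡 3) x,
        (∀ i, ContMDiff (𝓡 3) ((𝓡 3).prod 𝓘(ℝ, E3)) ∞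
          fun y ↦ (TotalSpace.mk' E3 y (F i y) : TangentBundle (𝓡 3) X)) ∧
        ∀ x i j, D.h.inner x (F i x) (F j x) = if i = j then 1 else 0)
    (hW : ∀ (X : Type) [TopologicalSpace X] [ChartedSpace E3 X] [IsManifold (𝓡 3) ∞ X]
      [T2Space X] [SecondCountableTopology X] [ConnectedSpace X]
      (D : InitialDataSet (𝓡 3) X) [D.metric.HasLeviCivita] (e : AFEnd X),
      D.SatisfiesDominantEnergyCondition → e.IsAsymptoticallyFlat D 1 →
      (∃ q₀, HasSourceDecay e D q₀) → e.IsSoleEnd → e.HasADMEnergy D 0 →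
      ∀ F : Fin 3 → Π x : X, TangentSpace (𝓡 3) x,
        (∀ i, ContMDiff (𝓡 3) ((𝓡 3).prod 𝓘(ℝ, E3)) ∞
          fun y ↦ (TotalSpace.mk' E3 y (F i y) : TangentBundle (𝓡 3) X)) →
        (∀ x i j, D.h.inner x (F i x) (F j x) = if i = j then 1 else 0) →
        ∃ (ψ₁ ψ₂ : X → PauliModel.Spinor) (l : Filter X), l.NeBot ∧
          ContMDiff (𝓡 3) 𝓘(ℝ, PauliModel.Spinor) ∞ ψ₁ ∧
          ContMDiff (𝓡 3) 𝓘(ℝ, PauliModel.Spinor) ∞ ψ₂ ∧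
          (∀ (x : X) (v : TangentSpace (𝓡 3) x), mvfderiv (𝓡 3) ψ₁ x v =
            (1 / 4 : ℝ) • (∑ i, ∑ j,
              D.metric.val x (D.metric.leviCivita (F i) x v) (F j x) •
                PauliModel.pauli i (PauliModel.pauli j (ψ₁ x))) -
              (1 / 2 : ℝ) • ∑ i, D.k x v (F i x) • PauliModel.pauli i (ψ₁ x)) ∧
          (∀ (x : X) (v : TangentSpace (𝓡 3) x), mvfderiv (𝓡 3) ψ₂ x v =
            (1 / 4 : ℝ) • (∑ i, ∑ j,
              D.metric.val x (D.metric.leviCivita (F i) x v) (F j x) •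
                PauliModel.pauli i (PauliModel.pauli j (ψ₂ x))) -
              (1 / 2 : ℝ) • ∑ i, D.k x v (F i x) • PauliModel.pauli i (ψ₂ x)) ∧
          Tendsto ψ₁ l (𝓝 (EuclideanSpace.single 0 1)) ∧
          Tendsto ψ₂ l (𝓝 (EuclideanSpace.single 2 1))) :
    beigChrusciel_translationalKIDs_of_admEnergy_zero := by
  refine beigChrusciel_translationalKIDs_of_admEnergy_zero_of_unbounded ?_
  intro X _ _ _ _ _ _ D _ e hdec haf hsrc hsole hE
  obtain ⟨F, hF, horth⟩ := hFr X D e hdec haf hsrc hsole hE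
  obtain ⟨ψ₁, ψ₂, l, hl, h1s, h2s, h1, h2, hl₁, hl₂⟩ := hW X D e hdec haf hsrc hsole hE F hF horth
  haveI := hl
  obtain ⟨N, Y, hNs, hYs, hDY, hdN, hG, hN0⟩ :=
    PauliModel.exists_kids_of_pauli_parallel_spinors_of_tendsto D hF horth
      (fun i j x v ↦ D.metric.val x (D.metric.leviCivita (F i) x v) (F j x)) (fun _ _ _ _ ↦ rfl)
      h1s h2s h1 h2 hl₁ hl₂
  exact ⟨N, Y, hNs, hYs, hDY, hdN, hG, hN0⟩

/-- **The rigid positive energy theorem from a global orthonormal frame and Witten's parallel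
spinors alone** (no simple-connectivity input: it is discharged in the tree,
`positive_mass_rigidity_spacetime_of_analyticHalf` with `KIDSimplyConnected.lean`).
[cite: BeigChrusciel1996, Thm. 4.1, §4 and App. A] -/
theorem positive_mass_rigidity_spacetime_of_frame_of_witten
    (hFr : ∀ (X : Type) [TopologicalSpace X] [ChartedSpace E3 X] [IsManifold (𝓡 3) ∞ X]
      [T2Space X] [SecondCountableTopology X] [ConnectedSpace X]
      (D : InitialDataSet (𝓡 3) X) [D.metric.HasLeviCivita] (e : AFEnd X),
      D.SatisfiesDominantEnergyCondition → e.IsAsymptoticallyFlat D 1 →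
      (∃ q₀, HasSourceDecay e D q₀) → e.IsSoleEnd → e.HasADMEnergy D 0 →
      ∃ F : Fin 3 → Π x : X, TangentSpace (𝓡 3) x,
        (∀ i, ContMDiff (𝓡 3) ((𝓡 3).prod 𝓘(ℝ, E3)) ∞
          fun y ↦ (TotalSpace.mk' E3 y (F i y) : TangentBundle (𝓡 3) X)) ∧
        ∀ x i j, D.h.inner x (F i x) (F j x) = if i = j then 1 else 0)
    (hW : ∀ (X : Type) [TopologicalSpace X] [ChartedSpace E3 X] [IsManifold (𝓡 3) ∞ X]
      [T2Space X] [SecondCountableTopology X] [ConnectedSpace X]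
      (D : InitialDataSet (𝓡 3) X) [D.metric.HasLeviCivita] (e : AFEnd X),
      D.SatisfiesDominantEnergyCondition → e.IsAsymptoticallyFlat D 1 →
      (∃ q₀, HasSourceDecay e D q₀) → e.IsSoleEnd → e.HasADMEnergy D 0 →
      ∀ F : Fin 3 → Π x : X, TangentSpace (𝓡 3) x,
        (∀ i, ContMDiff (𝓡 3) ((𝓡 3).prod 𝓘(ℝ, E3)) ∞
          fun y ↦ (TotalSpace.mk' E3 y (F i y) : TangentBundle (𝓡 3) X)) →
        (∀ x i j, D.h.inner x (F i x) (F j x) = if i = j then 1 else 0) →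
        ∃ (ψ₁ ψ₂ : X → PauliModel.Spinor) (l : Filter X), l.NeBot ∧
          ContMDiff (𝓡 3) 𝓘(ℝ, PauliModel.Spinor) ∞ ψ₁ ∧
          ContMDiff (𝓡 3) 𝓘(ℝ, PauliModel.Spinor) ∞ ψ₂ ∧
          (∀ (x : X) (v : TangentSpace (𝓡 3) x), mvfderiv (𝓡 3) ψ₁ x v =
            (1 / 4 : ℝ) • (∑ i, ∑ j,
              D.metric.val x (D.metric.leviCivita (F i) x v) (F j x) •
                PauliModel.pauli i (PauliModel.pauli j (ψ₁ x))) -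
              (1 / 2 : ℝ) • ∑ i, D.k x v (F i x) • PauliModel.pauli i (ψ₁ x)) ∧
          (∀ (x : X) (v : TangentSpace (𝓡 3) x), mvfderiv (𝓡 3) ψ₂ x v =
            (1 / 4 : ℝ) • (∑ i, ∑ j,
              D.metric.val x (D.metric.leviCivita (F i) x v) (F j x) •
                PauliModel.pauli i (PauliModel.pauli j (ψ₂ x))) -
              (1 / 2 : ℝ) • ∑ i, D.k x v (F i x) • PauliModel.pauli i (ψ₂ x)) ∧
          Tendsto ψ₁ l (𝓝 (EuclideanSpace.single 0 1)) ∧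
          Tendsto ψ₂ l (𝓝 (EuclideanSpace.single 2 1))) :
    positive_mass_rigidity_spacetime :=
  positive_mass_rigidity_spacetime_of_analyticHalf
    (beigChrusciel_translationalKIDs_of_admEnergy_zero_of_witten hFr hW)

end Literature.Geometry.Lorentzian

end
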